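import Summits.QuantumFields.YangMills.Theses.ConvexGribovBody
import Summits.QuantumFields.YangMills.Theorems.PoincareToGap.Negative.PlaquetteVariance
import Summits.QuantumFields.YangMills.Theorems.BrascampLiebVacuum.Negative.FalseWithoutLocality

/-!
# `NonSimplyConnectedLatticeGap` — negative side: which quantifiers of the clustering body carry content

Negative-side support for crux `stmt-QuantumFields-16405`
(`Summit.QuantumFields.YangMills.Theses.ConvexGribovBody.NonSimplyConnectedLatticeGap`: `∃ β₀, ∀ β ≥ β₀,
∃ m > 0, ∃ S₁, ∀ A B, ∃ C, ∀ S n, S₁ ≤ S → n ≤ S → |corr_S(A,B,n)| ≤ C e^{-mn}` under Wilson's torus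
measure, for the compact simple `G` with `π₁ ≠ 0`), extracted from the standing disprover's work file
`Cruxes/NonSimplyConnectedLatticeGap/Disproof.lean` §A2, §B. Every `G`, `r`, real `β`, `m`;
nothing here asserts a Theses statement.

* `abs_le_sum_mul_exp` — finitely many separations are always absorbed into the constant.
* `perVolume_clustering_trivial` — if `C` may depend on the torus (`∀ S, ∃ C, ∀ n ≤ S`), the body
  holds for EVERY `G, r, β, m` with no hypothesis at all: the whole content of the crux is the
  `S`-uniformity of `C(A, B)`.
* `clustering_iff_noS₁` — at fixed `(ρ, β, m)` the body with `∃ S₁, … S₁ ≤ S →` is EQUIVALENT to the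
  body with `S₁` deleted: the threshold `S₁` ("large tori only") is cosmetic, it cannot be used by a
  proof; small tori are in the statement and harmless only because `n ≤ S`.
* `no_uniform_clustering_constant` — the natural strengthening "one `C` for all pairs `A, B`" fails
  for every admissible `(G, r)`, `β`, `m`, `S₁` (scale the plaquette against its volume-uniform
  variance, `PoincareToGap.Negative.exists_cov_lower_bound`): `C(A,B)` must grow like `‖A‖∞‖B‖∞`,
  so the crux's `∀ A B, ∃ C` order is forced.
-/

noncomputable section

namespace Summit.QuantumFields.YangMills.Theorems.NonSimplyConnectedLatticeGap.Negative

open MeasureTheory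
open Literature.MathematicalPhysics.QuantumFieldTheory
open Literature.MathematicalPhysics.QuantumLattice (torusLift configShift LGConfig)

variable {G : Type} [Group G] [TopologicalSpace G] [IsTopologicalGroup G] [CompactSpace G]
  [MeasurableSpace G] [BorelSpace G]

/-- Finitely many separations are always absorbed: for any real sequence `a` and any `m`, on the
finite set `n ≤ S` one has `|a n| ≤ (Σ_{n' ≤ S} |a n'| e^{m n'}) e^{-m n}`. [folklore] -/
theorem abs_le_sum_mul_exp (a : ℕ → ℝ) (m : ℝ) (S n : ℕ) (hn : n ≤ S) :
    |a n| ≤ (∑ n' ∈ Finset.range (S + 1), |a n'| * Real.exp (m * n')) * Real.exp (-(m * n)) := by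
  have hmem : n ∈ Finset.range (S + 1) := Finset.mem_range.2 (Nat.lt_succ_of_le hn)
  have hle : |a n| * Real.exp (m * n) ≤ ∑ n' ∈ Finset.range (S + 1), |a n'| * Real.exp (m * n') :=
    Finset.single_le_sum (f := fun n' => |a n'| * Real.exp (m * n'))
      (fun n' _ => mul_nonneg (abs_nonneg _) (Real.exp_nonneg _)) hmem
  have hexp : Real.exp (m * n) * Real.exp (-(m * n)) = 1 := by
    rw [← Real.exp_add, add_neg_cancel, Real.exp_zero]
  calc |a n| = |a n| * Real.exp (m * n) * Real.exp (-(m * n)) := by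
        rw [mul_assoc, hexp, mul_one]
    _ ≤ _ := mul_le_mul_of_nonneg_right hle (Real.exp_nonneg _)

/-- **The per-volume variant is trivially TRUE** (every `G`, `ρ`, `β`, `m`, no hypothesis): if the
constant may depend on the torus, `n ≤ S` leaves finitely many separations. [folklore] -/
theorem perVolume_clustering_trivial {N : ℕ} (ρ : G →* Matrix (Fin N) (Fin N) ℂ) (β m : ℝ) (A B : LGConfig 4 G → ℝ) (S : ℕ) :
    ∃ C : ℝ, ∀ n : ℕ, n ≤ S →
      |latticeConnectedCorr ρ β (2 * S + 1) A B n| ≤ C * Real.exp (-(m * n)) :=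
  ⟨_, fun n hn => abs_le_sum_mul_exp (fun n => latticeConnectedCorr ρ β (2 * S + 1) A B n) m S n hn⟩

/-- **`S₁` is cosmetic.** At fixed `(ρ, β, m)` the clustering body with a threshold `S₁` is
equivalent to the body without it: the finitely many pairs `n ≤ S < S₁` are absorbed into
`C(A, B)`. [folklore] -/
theorem clustering_iff_noS₁ {N : ℕ} (ρ : G →* Matrix (Fin N) (Fin N) ℂ) (β m : ℝ) :
    (∃ S₁ : ℕ, ∀ A B : YMSpecies G, ∃ C : ℝ, ∀ S n : ℕ, S₁ ≤ S → n ≤ S →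
      |latticeConnectedCorr ρ β (2 * S + 1) A.F B.F n| ≤ C * Real.exp (-(m * n))) ↔
    (∀ A B : YMSpecies G, ∃ C : ℝ, ∀ S n : ℕ, n ≤ S →
      |latticeConnectedCorr ρ β (2 * S + 1) A.F B.F n| ≤ C * Real.exp (-(m * n))) := by
  constructor
  · rintro ⟨S₁, h⟩ A B
    obtain ⟨C, hC⟩ := h A B
    set D : ℝ := ∑ S ∈ Finset.range S₁, ∑ n' ∈ Finset.range (S + 1),
      |latticeConnectedCorr ρ β (2 * S + 1) A.F B.F n'| * Real.exp (m * n') with hD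
    refine ⟨max C D, fun S n hn => ?_⟩
    by_cases hS : S₁ ≤ S
    · exact (hC S n hS hn).trans
        (mul_le_mul_of_nonneg_right (le_max_left _ _) (Real.exp_nonneg _))
    · have hSmem : S ∈ Finset.range S₁ := Finset.mem_range.2 (not_le.1 hS)
      have h1 := abs_le_sum_mul_exp (fun n => latticeConnectedCorr ρ β (2 * S + 1) A.F B.F n) m S n hn
      have h2 : (∑ n' ∈ Finset.range (S + 1),
          |latticeConnectedCorr ρ β (2 * S + 1) A.F B.F n'| * Real.exp (m * n')) ≤ D :=
        Finset.single_le_sum (f := fun S => ∑ n' ∈ Finset.range (S + 1),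
            |latticeConnectedCorr ρ β (2 * S + 1) A.F B.F n'| * Real.exp (m * n'))
          (fun S _ => Finset.sum_nonneg fun n' _ => mul_nonneg (abs_nonneg _) (Real.exp_nonneg _))
          hSmem
      exact h1.trans (mul_le_mul_of_nonneg_right (h2.trans (le_max_right _ _)) (Real.exp_nonneg _))
  · intro h
    exact ⟨0, fun A B => (h A B).imp fun C hC S n _ hn => hC S n hn⟩

/-- `corr` is bilinear: scaling both observables by `c` scales it by `c²` (pure algebra of the
Bochner integral, valid for every measure). [folklore] -/
theorem latticeConnectedCorr_smul {N : ℕ} (ρ : G →* Matrix (Fin N) (Fin N) ℂ) (β : ℝ) (L : ℕ)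
    [NeZero L] (A B : LGConfig 4 G → ℝ) (c : ℝ) (n : ℕ) :
    latticeConnectedCorr ρ β L (fun U => c * A U) (fun U => c * B U) n =
      c ^ 2 * latticeConnectedCorr ρ β L A B n := by
  simp only [latticeConnectedCorr]
  have h1 : ∀ (U : GaugeConfig 4 L G),
      c * A (torusLift L U) * (c * B (configShift (-Pi.single 0 (n : ℤ)) (torusLift L U))) =
        c ^ 2 * (A (torusLift L U) * B (configShift (-Pi.single 0 (n : ℤ)) (torusLift L U))) :=
    fun U => by ring
  simp_rw [h1, integral_const_mul]
  ring

/-- **No constant uniform in the observables.** For every admissible `(G, r)` (only `∃ a ≠ 1` of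
`IsCompactSimpleLieGroup` is used), every `β`, `m` and `S₁`, there is NO single `C` serving all
pairs `A, B` in the clustering body: the plaquette scaled by `c` has equal-time covariance
`c² Var_S ≥ c² v`, `v > 0` uniform in `S ≥ 1` (`PoincareToGap.Negative.exists_cov_lower_bound`).
[folklore] -/
theorem no_uniform_clustering_constant (hG : IsCompactSimpleLieGroup G) (r : LatticeRep G)
    (β m : ℝ) (S₁ : ℕ) :
    ¬ ∃ C : ℝ, ∀ A B : YMSpecies G, ∀ S n : ℕ, S₁ ≤ S → n ≤ S →
      |latticeConnectedCorr r.ρ β (2 * S + 1) A.F B.F n| ≤ C * Real.exp (-(m * n)) := by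
  rintro ⟨C, hC⟩
  obtain ⟨g₀, hg₀⟩ := BrascampLiebVacuum.Negative.exists_ne_one_of_isCompactSimpleLieGroup hG
  obtain ⟨A, v, hv, hA⟩ := PoincareToGap.Negative.exists_cov_lower_bound r hg₀ β
  have hvS := hA (max S₁ 1) (le_max_right _ _)
  obtain ⟨c, hc⟩ : ∃ c : ℝ, C < c ^ 2 * v := by
    refine ⟨Real.sqrt (|C| / v + 1), ?_⟩
    rw [Real.sq_sqrt (by positivity), add_mul, div_mul_cancel₀ _ hv.ne', one_mul]
    linarith [le_abs_self C]
  -- the scaled plaquette as a gauge-invariant local observable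
  obtain ⟨K, hK⟩ := A.bounded
  let A' : YMSpecies G :=
    { F := fun U => c * A.F U
      supp := A.supp
      isCylinder := fun U V h => by
        show c * A.F U = c * A.F V
        rw [A.isCylinder h]
      gaugeInvariant := fun g U => by
        show c * A.F _ = c * A.F U
        rw [A.gaugeInvariant g U]
      bounded := ⟨|c| * K, fun U => by
        rw [abs_mul]; exact mul_le_mul_of_nonneg_left (hK U) (abs_nonneg _)⟩
      measurable := A.measurable.const_mul c }
  have hF : A'.F = fun U => c * A.F U := rfl
  have h := hC A' A' (max S₁ 1) 0 (le_max_left _ _) (Nat.zero_le _)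
  simp only [Nat.cast_zero, mul_zero, neg_zero, Real.exp_zero, mul_one] at h
  rw [hF, latticeConnectedCorr_smul, abs_mul, abs_pow, sq_abs] at h
  have : c ^ 2 * v ≤ C := (mul_le_mul_of_nonneg_left hvS (sq_nonneg c)).trans h
  linarith

end Summit.QuantumFields.YangMills.Theorems.NonSimplyConnectedLatticeGap.Negative

end
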